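import Mathlib.Analysis.Calculus.BumpFunction.Normed
import Mathlib.Analysis.Calculus.BumpFunction.InnerProduct
import Mathlib.Analysis.Calculus.ContDiff.Deriv
import Mathlib.MeasureTheory.Integral.IntervalIntegral.FundThmCalculus
import Mathlib.Analysis.SpecialFunctions.Integrals.Basic
import HarnessLib

/-!
# Smooth truncations and the associated renormalisers

Analysis/Calculus support file (everything proved). For a level `M` we construct the smooth
truncation `S_M` and renormaliser `β_M` of the DiPerna–Lions renormalisation argument in its
`L²` form (DiPerna–Lions 1989, §II.3: "`β ∈ C¹`, `β'` bounded"; here smooth, so that `β ∘ A` is an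
admissible test function on the torus):

* `truncCutoff M : ContDiffBump 0` — a smooth `χ : ℝ → [0, 1]`, `χ = 1` on `[-M', M']`,
  `χ = 0` off `(-M'-1, M'+1)`, `M' = max M 1`;
* `trunc M x = ∫₀ˣ χ` — smooth, `trunc' = χ`, `trunc M x = x` for `|x| ≤ M`, `1`-Lipschitz,
  `|trunc M x| ≤ |x|`, `trunc M 0 = 0`;
* `renormDeriv M y = ∫₀ʸ 2χ²`, `renorm M x = ∫₀ˣ renormDeriv M` — smooth, `renorm' = renormDeriv`,
  `renormDeriv' = 2χ² = 2 (trunc')²` (**the key identity** `deriv_renormDeriv_eq`),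
  `|renormDeriv M y| ≤ 4 (M' + 1)` (so `renorm` is Lipschitz with a bounded derivative),
  `|renormDeriv M y| ≤ 2|y|`, and `0 ≤ renorm M x ≤ x²`.

## References

* R. J. DiPerna, P.-L. Lions, Invent. Math. 98 (1989), §II.3. [`DiPernaLions1989`]
-/

noncomputable section

open MeasureTheory Set Filter Topology intervalIntegral Metric
open scoped Interval ContDiff

namespace Literature.Analysis.Calculus

/-! ## The cutoff -/

/-- The cutoff of the truncation: a smooth bump `χ` on `ℝ` centred at `0`, equal to `1` on
`[-M', M']` and supported in `(-M'-1, M'+1)`, `M' = max M 1`. [folklore] -/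
def truncCutoff (M : ℝ) : ContDiffBump (0 : ℝ) :=
  ⟨max M 1, max M 1 + 1, by positivity, by linarith⟩

/-- `M ≤ M' = rIn`. [folklore] -/
theorem le_truncCutoff_rIn (M : ℝ) : M ≤ (truncCutoff M).rIn := le_max_left M 1

/-- `rOut = rIn + 1`. [folklore] -/
theorem truncCutoff_rOut (M : ℝ) : (truncCutoff M).rOut = (truncCutoff M).rIn + 1 := rfl

/-- The cutoff is `1` on `[-M, M]`. [folklore] -/
theorem truncCutoff_eq_one {M x : ℝ} (hx : |x| ≤ M) : (truncCutoff M) x = 1 :=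
  (truncCutoff M).one_of_mem_closedBall (by
    rw [mem_closedBall, dist_zero_right, Real.norm_eq_abs]
    exact hx.trans (le_truncCutoff_rIn M))

/-- `0 ≤ χ ≤ 1`, so `|χ| ≤ 1`. [folklore] -/
theorem abs_truncCutoff_le_one (M x : ℝ) : |(truncCutoff M) x| ≤ 1 := by
  rw [abs_of_nonneg (truncCutoff M).nonneg]
  exact (truncCutoff M).le_one

/-- The cutoff vanishes off `(-(rIn+1), rIn+1)`. [folklore] -/
theorem truncCutoff_eq_zero {M x : ℝ} (hx : (truncCutoff M).rIn + 1 ≤ |x|) : (truncCutoff M) x = 0 :=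
  (truncCutoff M).zero_of_le_dist (by rwa [dist_zero_right, Real.norm_eq_abs])

/-- The cutoff is continuous. [folklore] -/
theorem continuous_truncCutoff (M : ℝ) : Continuous (truncCutoff M : ℝ → ℝ) :=
  (truncCutoff M).continuous

/-! ## The truncation `S_M` -/

/-- The smooth truncation `S_M(x) = ∫₀ˣ χ`. [folklore] -/
def trunc (M x : ℝ) : ℝ := ∫ t in (0 : ℝ)..x, (truncCutoff M) t

/-- `S_M' = χ`. [folklore] -/
theorem hasDerivAt_trunc (M x : ℝ) : HasDerivAt (trunc M) ((truncCutoff M) x) x :=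
  integral_hasDerivAt_right ((continuous_truncCutoff M).intervalIntegrable _ _)
    ((continuous_truncCutoff M).stronglyMeasurableAtFilter _ _) (continuous_truncCutoff M).continuousAt

/-- `deriv S_M = χ`. [folklore] -/
theorem deriv_trunc (M : ℝ) : deriv (trunc M) = (truncCutoff M : ℝ → ℝ) :=
  funext fun x => (hasDerivAt_trunc M x).deriv

/-- `S_M` is smooth. [folklore] -/
theorem contDiff_trunc (M : ℝ) : ContDiff ℝ ∞ (trunc M) := by
  rw [contDiff_infty_iff_deriv, deriv_trunc]
  exact ⟨fun x => (hasDerivAt_trunc M x).differentiableAt, (truncCutoff M).contDiff⟩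

/-- `S_M 0 = 0`. [folklore] -/
theorem trunc_zero (M : ℝ) : trunc M 0 = 0 := integral_same

/-- `S_M x = x` for `|x| ≤ M`. [folklore] -/
theorem trunc_eq_self {M x : ℝ} (hx : |x| ≤ M) : trunc M x = x := by
  have h : EqOn (truncCutoff M : ℝ → ℝ) (fun _ => (1 : ℝ)) (uIcc (0 : ℝ) x) := fun t ht => by
    refine truncCutoff_eq_one ?_
    rw [mem_uIcc] at ht
    rcases ht with h | h
    · rw [abs_of_nonneg h.1]; exact h.2.trans ((le_abs_self x).trans hx)
    · rw [abs_of_nonpos h.2]; linarith [neg_le_abs x, h.1]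
  rw [trunc, intervalIntegral.integral_congr h]
  simp

/-- `S_M` is `1`-Lipschitz: `|S_M x - S_M y| ≤ |x - y|`. [folklore] -/
theorem abs_trunc_sub_trunc_le (M x y : ℝ) : |trunc M x - trunc M y| ≤ |x - y| := by
  rw [trunc, trunc, integral_interval_sub_left ((continuous_truncCutoff M).intervalIntegrable _ _)
    ((continuous_truncCutoff M).intervalIntegrable _ _), ← Real.norm_eq_abs]
  have := norm_integral_le_of_norm_le_const (a := y) (b := x) (C := 1)
    (f := (truncCutoff M : ℝ → ℝ)) fun t _ => by
      rw [Real.norm_eq_abs]; exact abs_truncCutoff_le_one M t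
  simpa using this

/-- `S_M` is `1`-Lipschitz. [folklore] -/
theorem lipschitzWith_trunc (M : ℝ) : LipschitzWith 1 (trunc M) :=
  LipschitzWith.of_dist_le_mul fun x y => by
    rw [Real.dist_eq, Real.dist_eq, NNReal.coe_one, one_mul]
    exact abs_trunc_sub_trunc_le M x y

/-- `|S_M x| ≤ |x|`. [folklore] -/
theorem abs_trunc_le (M x : ℝ) : |trunc M x| ≤ |x| := by
  simpa [trunc_zero] using abs_trunc_sub_trunc_le M x 0

/-- For `M ≥ |x|` the truncation does nothing; in particular `S_M x → x` as `M → ∞`. [folklore] -/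
theorem tendsto_trunc_atTop (x : ℝ) : Tendsto (fun M => trunc M x) atTop (𝓝 x) :=
  tendsto_const_nhds.congr' (by
    filter_upwards [eventually_ge_atTop |x|] with M hM
    exact (trunc_eq_self hM).symm)

/-! ## The renormaliser `β_M` -/

/-- `β_M'(y) = ∫₀ʸ 2χ²`. [folklore] -/
def renormDeriv (M y : ℝ) : ℝ := ∫ r in (0 : ℝ)..y, 2 * (truncCutoff M) r ^ 2

/-- `β_M(x) = ∫₀ˣ β_M'`. [folklore] -/
def renorm (M x : ℝ) : ℝ := ∫ y in (0 : ℝ)..x, renormDeriv M y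

/-- `2χ²` is continuous. [folklore] -/
theorem continuous_two_mul_truncCutoff_sq (M : ℝ) :
    Continuous fun r : ℝ => 2 * (truncCutoff M) r ^ 2 :=
  continuous_const.mul ((continuous_truncCutoff M).pow 2)

/-- `(β_M')' = 2χ²`. [folklore] -/
theorem hasDerivAt_renormDeriv (M y : ℝ) :
    HasDerivAt (renormDeriv M) (2 * (truncCutoff M) y ^ 2) y :=
  integral_hasDerivAt_right ((continuous_two_mul_truncCutoff_sq M).intervalIntegrable _ _)
    ((continuous_two_mul_truncCutoff_sq M).stronglyMeasurableAtFilter _ _)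
    (continuous_two_mul_truncCutoff_sq M).continuousAt

/-- `deriv β_M' = 2χ²`. [folklore] -/
theorem deriv_renormDeriv (M : ℝ) : deriv (renormDeriv M) = fun y => 2 * (truncCutoff M) y ^ 2 :=
  funext fun y => (hasDerivAt_renormDeriv M y).deriv

/-- `β_M'` is smooth. [folklore] -/
theorem contDiff_renormDeriv (M : ℝ) : ContDiff ℝ ∞ (renormDeriv M) := by
  rw [contDiff_infty_iff_deriv, deriv_renormDeriv]
  exact ⟨fun y => (hasDerivAt_renormDeriv M y).differentiableAt,
    contDiff_const.mul ((truncCutoff M).contDiff.pow 2)⟩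

/-- `β_M'` is continuous. [folklore] -/
theorem continuous_renormDeriv (M : ℝ) : Continuous (renormDeriv M) :=
  (contDiff_renormDeriv M).continuous

/-- `β_M' = renormDeriv`: the derivative of `β_M`. [folklore] -/
theorem hasDerivAt_renorm (M x : ℝ) : HasDerivAt (renorm M) (renormDeriv M x) x :=
  integral_hasDerivAt_right ((continuous_renormDeriv M).intervalIntegrable _ _)
    ((continuous_renormDeriv M).stronglyMeasurableAtFilter _ _) (continuous_renormDeriv M).continuousAt

/-- `deriv β_M = β_M'`. [folklore] -/
theorem deriv_renorm (M : ℝ) : deriv (renorm M) = renormDeriv M :=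
  funext fun x => (hasDerivAt_renorm M x).deriv

/-- `β_M` is smooth. [folklore] -/
theorem contDiff_renorm (M : ℝ) : ContDiff ℝ ∞ (renorm M) := by
  rw [contDiff_infty_iff_deriv, deriv_renorm]
  exact ⟨fun x => (hasDerivAt_renorm M x).differentiableAt, contDiff_renormDeriv M⟩

/-- **The key identity** `β_M'' = 2 (S_M')²`. [folklore] -/
theorem deriv_renormDeriv_eq (M y : ℝ) : deriv (renormDeriv M) y = 2 * deriv (trunc M) y ^ 2 := by
  rw [deriv_renormDeriv, deriv_trunc]

/-- `β_M'' ≥ 0`. [folklore] -/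
theorem deriv_renormDeriv_nonneg (M y : ℝ) : 0 ≤ deriv (renormDeriv M) y := by
  rw [deriv_renormDeriv]; positivity

/-- `|β_M' y| ≤ 2|y|` (`2χ² ≤ 2`). [folklore] -/
theorem abs_renormDeriv_le (M y : ℝ) : |renormDeriv M y| ≤ 2 * |y| := by
  rw [renormDeriv, ← Real.norm_eq_abs]
  have h := norm_integral_le_of_norm_le_const (a := (0 : ℝ)) (b := y) (C := 2)
    (f := fun r : ℝ => 2 * (truncCutoff M) r ^ 2) fun r _ => by
      rw [Real.norm_eq_abs, abs_of_nonneg (by positivity)]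
      have h1 := abs_truncCutoff_le_one M r
      rw [abs_le] at h1
      nlinarith [(truncCutoff M).nonneg (x := r)]
  simpa using h

/-- `|β_M' y| ≤ 4 (rIn + 1)`: the integrand `2χ²` lives on `(-(rIn+1), rIn+1)`. [folklore] -/
theorem abs_renormDeriv_le_const (M y : ℝ) : |renormDeriv M y| ≤ 4 * ((truncCutoff M).rIn + 1) := by
  set R : ℝ := (truncCutoff M).rIn + 1 with hR
  have hR0 : 0 < R := by rw [hR]; linarith [(truncCutoff M).rIn_pos]
  -- reduce to `|y| ≤ R` by freezing the integral outside the support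
  have hfreeze : ∀ y : ℝ, R ≤ y → renormDeriv M y = renormDeriv M R := by
    intro y hy
    rw [renormDeriv, renormDeriv, ← integral_add_adjacent_intervals (b := R)
      ((continuous_two_mul_truncCutoff_sq M).intervalIntegrable _ _)
      ((continuous_two_mul_truncCutoff_sq M).intervalIntegrable _ _), add_eq_left,
      intervalIntegral.integral_congr (g := fun _ => (0 : ℝ)) (fun r hr => ?_), intervalIntegral.integral_zero]
    rw [uIcc_of_le hy] at hr
    have : (truncCutoff M) r = 0 :=
      truncCutoff_eq_zero (by rw [abs_of_nonneg (hR0.le.trans hr.1)]; exact hr.1)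
    simp [this]
  have hfreeze' : ∀ y : ℝ, y ≤ -R → renormDeriv M y = renormDeriv M (-R) := by
    intro y hy
    rw [renormDeriv, renormDeriv, ← integral_add_adjacent_intervals (b := -R)
      ((continuous_two_mul_truncCutoff_sq M).intervalIntegrable _ _)
      ((continuous_two_mul_truncCutoff_sq M).intervalIntegrable _ _), add_eq_left,
      intervalIntegral.integral_congr (g := fun _ => (0 : ℝ)) (fun r hr => ?_), intervalIntegral.integral_zero]
    rw [uIcc_of_ge hy] at hr
    have : (truncCutoff M) r = 0 :=
      truncCutoff_eq_zero (by rw [abs_of_nonpos (hr.2.trans (by linarith))]; linarith [hr.2])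
    simp [this]
  -- now bound
  have key : ∀ y : ℝ, |y| ≤ R → |renormDeriv M y| ≤ 4 * R := fun y hy =>
    (abs_renormDeriv_le M y).trans (by linarith)
  rcases le_or_gt y (-R) with h1 | h1
  · rw [hfreeze' y h1]
    exact key (-R) (by rw [abs_neg, abs_of_pos hR0])
  rcases le_or_gt R y with h2 | h2
  · rw [hfreeze y h2]
    exact key R (by rw [abs_of_pos hR0])
  · exact key y (abs_le.2 ⟨h1.le, h2.le⟩)

/-- `β_M` is Lipschitz (with constant `4 (rIn + 1)`). [folklore] -/
theorem lipschitzWith_renorm (M : ℝ) :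
    LipschitzWith (Real.toNNReal (4 * ((truncCutoff M).rIn + 1))) (renorm M) := by
  refine lipschitzWith_of_nnnorm_deriv_le (fun x => (hasDerivAt_renorm M x).differentiableAt) fun x => ?_
  rw [deriv_renorm, ← NNReal.coe_le_coe, coe_nnnorm, Real.norm_eq_abs,
    Real.coe_toNNReal _ (by linarith [(truncCutoff M).rIn_pos])]
  exact abs_renormDeriv_le_const M x

/-- `β_M' y ≥ 0` for `y ≥ 0`. [folklore] -/
theorem renormDeriv_nonneg {M y : ℝ} (hy : 0 ≤ y) : 0 ≤ renormDeriv M y :=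
  integral_nonneg_of_forall hy fun r => by positivity

/-- `β_M' y ≤ 0` for `y ≤ 0`. [folklore] -/
theorem renormDeriv_nonpos {M y : ℝ} (hy : y ≤ 0) : renormDeriv M y ≤ 0 := by
  rw [renormDeriv, integral_symm, neg_nonpos]
  exact integral_nonneg_of_forall hy fun r => by positivity

/-- `0 ≤ β_M x`. [folklore] -/
theorem renorm_nonneg (M x : ℝ) : 0 ≤ renorm M x := by
  rcases le_total 0 x with hx | hx
  · exact integral_nonneg hx fun y hy => renormDeriv_nonneg hy.1
  · rw [renorm, integral_symm, neg_nonneg]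
    rw [integral_of_le hx]
    refine setIntegral_nonpos measurableSet_Ioc fun y hy => renormDeriv_nonpos hy.2

/-- `β_M x ≤ x²`. [folklore] -/
theorem renorm_le_sq (M x : ℝ) : renorm M x ≤ x ^ 2 := by
  rcases le_total 0 x with hx | hx
  · calc renorm M x ≤ ∫ y in (0 : ℝ)..x, 2 * y :=
          integral_mono_on hx ((continuous_renormDeriv M).intervalIntegrable _ _)
            ((by fun_prop : Continuous fun y : ℝ => 2 * y).intervalIntegrable _ _) fun y hy => by
            have := abs_renormDeriv_le M y
            rw [abs_of_nonneg hy.1] at this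
            exact (le_abs_self _).trans this
      _ = x ^ 2 := by rw [intervalIntegral.integral_const_mul, integral_id]; ring
  · have h : renorm M x = -∫ y in x..(0 : ℝ), renormDeriv M y := by rw [renorm, integral_symm]
    rw [h, neg_le]
    calc -x ^ 2 = ∫ y in x..(0 : ℝ), 2 * y := by rw [intervalIntegral.integral_const_mul, integral_id]; ring
      _ ≤ ∫ y in x..(0 : ℝ), renormDeriv M y :=
          integral_mono_on hx ((by fun_prop : Continuous fun y : ℝ => 2 * y).intervalIntegrable _ _)
            ((continuous_renormDeriv M).intervalIntegrable _ _) fun y hy => by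
            have := abs_renormDeriv_le M y
            rw [abs_of_nonpos hy.2] at this
            have := neg_abs_le (renormDeriv M y)
            linarith

/-- `β_M 0 = 0`. [folklore] -/
theorem renorm_zero (M : ℝ) : renorm M 0 = 0 := integral_same

end Literature.Analysis.Calculus
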